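import Mathlib
import HarnessLib
import Literature.Analysis.FluidPDE.VectorCalculus
import Literature.Analysis.FluidPDE.AxisymHouLiVariables
import Summits.NavierStokesRegularity.NavierStokesRegularity.Theorems.HalfSpaceWindowDoorCirculationCarryingRigidityWindowedFlux
import Summits.NavierStokesRegularity.NavierStokesRegularity.Theorems.HalfSpaceWindowDoorCirculationCarryingRigidityTiltingIdentity

/-!
# Route `HalfSpaceWindowDoor`, crux `CirculationCarryingRigidity` (stmt-NavierStokesRegularity-25311) — the WINDOWED
# TILTING FLUX: transport-minus-stretching of `ω₃` pairs against the GRADIENT of the window (line `birth`, mechanism of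
# the open stub `stub_layerExclusion`)

Integrating the pointwise divergence structure of the `e₃`-vorticity equation
(`…TiltingIdentity.convect_sub_stretch_two_eq_divh`: `((u·∇)ω)₂ − ((ω·∇)u)₂ = ∂₀F₀ + ∂₁F₁`, `Fⱼ = uⱼω₂ − ωⱼu₂`, for
`div u = div ω = 0`) over a horizontal plane `{x₂ = c}` against the Gaussian window `g_{L,a}` and integrating by parts on
`ℝ²` (Mathlib's `integral_mul_fderiv_eq_neg_fderiv_mul_of_integrable`):

* `integral_fderiv_planePt_mul_gaussWin` — for a bounded `C¹` scalar `G` on `ℝ³` with bounded gradient and `j = 0, 1`: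
  `∫ (∂ⱼG)(y₀,y₁,c) g_{L,a}(y) dy = −∫ G(y₀,y₁,c) ∂ⱼg_{L,a}(y) dy` (with the integrability of both sides);
* `integral_convect_sub_stretch_two_mul_gaussWin` — for bounded `C¹` fields `u, ω` on `ℝ³` with bounded gradients and
  `div u = div ω = 0`:
  `∫ [((u·∇)ω)₂ − ((ω·∇)u)₂](y₀,y₁,c) g_{L,a}(y) dy = −∫ F₀ ∂₀g_{L,a} − ∫ F₁ ∂₁g_{L,a}`;
* `abs_integral_convect_sub_stretch_two_mul_gaussWin_le` — hence `|∫ [((u·∇)ω)₂ − ((ω·∇)u)₂] g_{L,a}| ≤ 8 B_u B_ω / L`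
  (`|Fⱼ| ≤ 2B_uB_ω`, `‖∇g_{L,a}‖_{L¹} ≤ 2/L`): the transport–tilting source of the windowed `e₃`-flux is `O(1/L)` — the
  quantitative form of "transport and stretching are exact in-plane divergences for the `e₃`-component" in the skeleton
  of record of crux 25311.

Seat ns-hsw-p1 (LEAD of 25311, cell pub-ns-dss).  WHAT THIS IS NOT: not a statement about Navier–Stokes regularity; plane
calculus for HYPOTHETICAL Type-I profiles; helper lemmas `--supports` the crux item, no closure claim.
-/

noncomputable section

-- the summit and its single sub-problem share the name (CONVENTIONS §1), as in every Theorems file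
set_option linter.dupNamespace false

namespace Summit.NavierStokesRegularity.NavierStokesRegularity.Theorems.HalfSpaceWindowDoorCirculationCarryingRigidityTiltingFlux

open MeasureTheory Set Function Filter Topology
open scoped RealInnerProductSpace InnerProductSpace ENNReal
open Literature.Analysis Literature.Analysis.FluidPDE
open Summit.NavierStokesRegularity.NavierStokesRegularity.Theorems.HalfSpaceWindowDoorCirculationCarryingRigidityDefs
open Summit.NavierStokesRegularity.NavierStokesRegularity.Theorems.HalfSpaceWindowDoorCirculationCarryingRigidityWindowedFlux
  (hasFDerivAt_planePt planePtDeriv_apply_single continuous_planePt integrable_gaussWin differentiable_gaussWin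
    integrable_fderiv_gaussWin integral_norm_fderiv_gaussWin_le abs_fderiv_gaussWin_apply_le)
open Summit.NavierStokesRegularity.NavierStokesRegularity.Theorems.HalfSpaceWindowDoorCirculationCarryingRigidityTiltingIdentity
  (convect_sub_stretch_two_eq_divh fderiv_flux_apply differentiableAt_coord)

/-! ### Integration by parts of an in-plane derivative against the window -/

section PlaneIBP

variable {G : EuclideanSpace ℝ (Fin 3) → ℝ}

/-- Chain rule along the plane chart for a scalar: `∂_{yⱼ}[G(y₀,y₁,c)] = (DG(y₀,y₁,c)) eⱼ` (`j = 0, 1`). -/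
theorem fderiv_comp_planePt_apply {c : ℝ} {y : EuclideanSpace ℝ (Fin 2)} (hG : DifferentiableAt ℝ G (planePt c y))
    (j : Fin 2) :
    fderiv ℝ (fun y => G (planePt c y)) y (EuclideanSpace.single j 1) =
      fderiv ℝ G (planePt c y) (EuclideanSpace.single (Fin.castSucc j) 1) := by
  have h : HasFDerivAt (fun y => G (planePt c y))
      ((fderiv ℝ G (planePt c y)).comp
        ((EuclideanSpace.proj 0 : EuclideanSpace ℝ (Fin 2) →L[ℝ] ℝ).smulRight (EuclideanSpace.single 0 (1 : ℝ) : EuclideanSpace ℝ (Fin 3)) +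
          (EuclideanSpace.proj 1 : EuclideanSpace ℝ (Fin 2) →L[ℝ] ℝ).smulRight (EuclideanSpace.single 1 (1 : ℝ) : EuclideanSpace ℝ (Fin 3)))) y :=
    hG.hasFDerivAt.comp y (hasFDerivAt_planePt c y)
  rw [h.fderiv, ContinuousLinearMap.comp_apply, planePtDeriv_apply_single]

/-- **In-plane integration by parts against the window.**  For a bounded `C¹` scalar `G` on `ℝ³` with bounded gradient,
`L > 0`, a height `c`, a centre `a` and `j = 0, 1`: the integrands are integrable on `ℝ²` and
`∫ (∂ⱼG)(y₀,y₁,c) g_{L,a}(y) dy = −∫ G(y₀,y₁,c) ∂ⱼg_{L,a}(y) dy`. -/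
theorem integral_fderiv_planePt_mul_gaussWin (hG : ContDiff ℝ 1 G) {B M : ℝ} (hB : ∀ x, ‖G x‖ ≤ B)
    (hM : ∀ x, ‖fderiv ℝ G x‖ ≤ M) {L : ℝ} (hL : 0 < L) (c : ℝ) (a : EuclideanSpace ℝ (Fin 2)) (j : Fin 2) :
    Integrable (fun y => fderiv ℝ G (planePt c y) (EuclideanSpace.single (Fin.castSucc j) 1) * gaussWin L a y) ∧
      Integrable (fun y => G (planePt c y) * fderiv ℝ (gaussWin L a) y (EuclideanSpace.single j 1)) ∧
      ∫ y, fderiv ℝ G (planePt c y) (EuclideanSpace.single (Fin.castSucc j) 1) * gaussWin L a y =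
        -∫ y, G (planePt c y) * fderiv ℝ (gaussWin L a) y (EuclideanSpace.single j 1) := by
  set φ : EuclideanSpace ℝ (Fin 2) → ℝ := fun y => G (planePt c y) with hφ
  set g : EuclideanSpace ℝ (Fin 2) → ℝ := gaussWin L a with hg
  have hGd : Differentiable ℝ G := hG.differentiable one_ne_zero
  have hGc : Continuous (fderiv ℝ G) := hG.continuous_fderiv one_ne_zero
  have hφ_diff : Differentiable ℝ φ := fun y => ((hGd _).hasFDerivAt.comp y (hasFDerivAt_planePt c y)).differentiableAt
  have hφ_cont : Continuous φ := hGd.continuous.comp (continuous_planePt c)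
  have hφ_bdd : ∀ y, ‖φ y‖ ≤ B := fun y => hB _
  -- the chart partial derivative of `φ` is the in-plane derivative of `G`
  have hDφ : ∀ y, fderiv ℝ φ y (EuclideanSpace.single j 1) =
      fderiv ℝ G (planePt c y) (EuclideanSpace.single (Fin.castSucc j) 1) :=
    fun y => fderiv_comp_planePt_apply (hGd _) j
  have hDφ_cont : Continuous (fun y => fderiv ℝ φ y (EuclideanSpace.single j 1)) := by
    simp_rw [hDφ]
    exact (hGc.comp (continuous_planePt c)).clm_apply continuous_const
  have hDφ_bdd : ∀ y, ‖fderiv ℝ φ y (EuclideanSpace.single j 1)‖ ≤ M := by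
    intro y
    rw [hDφ]
    refine (ContinuousLinearMap.le_opNorm _ _).trans ?_
    rw [PiLp.norm_single, norm_one, mul_one]
    exact hM _
  have hg_int : Integrable g := integrable_gaussWin hL a
  have hg_diff : Differentiable ℝ g := differentiable_gaussWin L a
  have hDgj_int : Integrable (fun y => fderiv ℝ g y (EuclideanSpace.single j 1)) :=
    (integrable_fderiv_gaussWin hL a).apply_continuousLinearMap _
  have I1 : Integrable (fun y => fderiv ℝ φ y (EuclideanSpace.single j 1) * g y) :=
    hg_int.bdd_mul hDφ_cont.aestronglyMeasurable (ae_of_all _ hDφ_bdd)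
  have I2 : Integrable (fun y => φ y * fderiv ℝ g y (EuclideanSpace.single j 1)) :=
    hDgj_int.bdd_mul hφ_cont.aestronglyMeasurable (ae_of_all _ hφ_bdd)
  have I3 : Integrable (fun y => φ y * g y) :=
    hg_int.bdd_mul hφ_cont.aestronglyMeasurable (ae_of_all _ hφ_bdd)
  have IBP := integral_mul_fderiv_eq_neg_fderiv_mul_of_integrable (μ := volume) I1 I2 I3
    (fun y _ => hφ_diff y) (fun y _ => hg_diff y)
  have I1' : Integrable (fun y => fderiv ℝ G (planePt c y) (EuclideanSpace.single (Fin.castSucc j) 1) * gaussWin L a y) :=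
    I1.congr (Eventually.of_forall fun y => by simp only [hDφ y, hg])
  refine ⟨I1', I2, ?_⟩
  have heq : (fun y => fderiv ℝ G (planePt c y) (EuclideanSpace.single (Fin.castSucc j) 1) * gaussWin L a y) =
      fun y => fderiv ℝ φ y (EuclideanSpace.single j 1) * g y :=
    funext fun y => by rw [hDφ y]
  -- `IBP : ∫ φ ∂ⱼg = −∫ ∂ⱼφ g`, so `∫ ∂ⱼφ g = −∫ φ ∂ⱼg`
  rw [heq, IBP, neg_neg]

end PlaneIBP

/-! ### The windowed tilting flux -/

section TiltingFlux

variable {u w : EuclideanSpace ℝ (Fin 3) → EuclideanSpace ℝ (Fin 3)}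

/-- The horizontal flux component `Fⱼ = uⱼw₂ − wⱼu₂` of `C¹` fields is `C¹`. -/
theorem contDiff_flux (hu : ContDiff ℝ 1 u) (hw : ContDiff ℝ 1 w) (j : Fin 3) :
    ContDiff ℝ 1 (fun x => u x j * w x 2 - w x j * u x 2) :=
  ((contDiff_apply_coord_vec3 hu j).mul (contDiff_apply_coord_vec3 hw 2)).sub
    ((contDiff_apply_coord_vec3 hw j).mul (contDiff_apply_coord_vec3 hu 2))

/-- The flux component is bounded: `|uⱼw₂ − wⱼu₂| ≤ 2 B_u B_w`. -/
theorem norm_flux_le {Bu Bw : ℝ} (hBu : ∀ x, ‖u x‖ ≤ Bu) (hBw : ∀ x, ‖w x‖ ≤ Bw) (j : Fin 3)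
    (x : EuclideanSpace ℝ (Fin 3)) : ‖u x j * w x 2 - w x j * u x 2‖ ≤ 2 * Bu * Bw := by
  have hBu0 : 0 ≤ Bu := (norm_nonneg _).trans (hBu 0)
  have h1 : ‖u x j‖ ≤ Bu := (PiLp.norm_apply_le (u x) j).trans (hBu x)
  have h2 : ‖w x 2‖ ≤ Bw := (PiLp.norm_apply_le (w x) 2).trans (hBw x)
  have h3 : ‖w x j‖ ≤ Bw := (PiLp.norm_apply_le (w x) j).trans (hBw x)
  have h4 : ‖u x 2‖ ≤ Bu := (PiLp.norm_apply_le (u x) 2).trans (hBu x)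
  calc ‖u x j * w x 2 - w x j * u x 2‖ ≤ ‖u x j * w x 2‖ + ‖w x j * u x 2‖ := norm_sub_le _ _
    _ = ‖u x j‖ * ‖w x 2‖ + ‖w x j‖ * ‖u x 2‖ := by rw [norm_mul, norm_mul]
    _ ≤ Bu * Bw + Bw * Bu := by
        gcongr
        · exact (norm_nonneg _).trans h2
    _ = 2 * Bu * Bw := by ring

/-- The gradient of the flux component is bounded: `‖D(uⱼw₂ − wⱼu₂)‖ ≤ 2 (M_u B_w + B_u M_w)`. -/
theorem norm_fderiv_flux_le (hu : ContDiff ℝ 1 u) (hw : ContDiff ℝ 1 w) {Bu Bw Mu Mw : ℝ}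
    (hBu : ∀ x, ‖u x‖ ≤ Bu) (hBw : ∀ x, ‖w x‖ ≤ Bw) (hMu : ∀ x, ‖fderiv ℝ u x‖ ≤ Mu)
    (hMw : ∀ x, ‖fderiv ℝ w x‖ ≤ Mw) (j : Fin 3) (x : EuclideanSpace ℝ (Fin 3)) :
    ‖fderiv ℝ (fun x => u x j * w x 2 - w x j * u x 2) x‖ ≤ 2 * (Mu * Bw + Bu * Mw) := by
  have hBu0 : 0 ≤ Bu := (norm_nonneg _).trans (hBu 0)
  have hBw0 : 0 ≤ Bw := (norm_nonneg _).trans (hBw 0)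
  have hMu0 : 0 ≤ Mu := (norm_nonneg _).trans (hMu 0)
  have hMw0 : 0 ≤ Mw := (norm_nonneg _).trans (hMw 0)
  have hud : DifferentiableAt ℝ u x := (hu.differentiable one_ne_zero) x
  have hwd : DifferentiableAt ℝ w x := (hw.differentiable one_ne_zero) x
  refine ContinuousLinearMap.opNorm_le_bound _ (by positivity) fun h => ?_
  rw [fderiv_flux_apply hud hwd]
  have e1 : ∀ (i : Fin 3), ‖fderiv ℝ u x h i‖ ≤ Mu * ‖h‖ := fun i =>
    (PiLp.norm_apply_le _ i).trans ((ContinuousLinearMap.le_opNorm _ _).trans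
      (mul_le_mul_of_nonneg_right (hMu x) (norm_nonneg _)))
  have e2 : ∀ (i : Fin 3), ‖fderiv ℝ w x h i‖ ≤ Mw * ‖h‖ := fun i =>
    (PiLp.norm_apply_le _ i).trans ((ContinuousLinearMap.le_opNorm _ _).trans
      (mul_le_mul_of_nonneg_right (hMw x) (norm_nonneg _)))
  have b1 : ∀ i, ‖u x i‖ ≤ Bu := fun i => (PiLp.norm_apply_le (u x) i).trans (hBu x)
  have b2 : ∀ i, ‖w x i‖ ≤ Bw := fun i => (PiLp.norm_apply_le (w x) i).trans (hBw x)
  calc ‖fderiv ℝ u x h j * w x 2 + u x j * fderiv ℝ w x h 2 - (fderiv ℝ w x h j * u x 2 + w x j * fderiv ℝ u x h 2)‖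
      ≤ ‖fderiv ℝ u x h j * w x 2 + u x j * fderiv ℝ w x h 2‖ + ‖fderiv ℝ w x h j * u x 2 + w x j * fderiv ℝ u x h 2‖ :=
        norm_sub_le _ _
    _ ≤ (‖fderiv ℝ u x h j‖ * ‖w x 2‖ + ‖u x j‖ * ‖fderiv ℝ w x h 2‖) +
          (‖fderiv ℝ w x h j‖ * ‖u x 2‖ + ‖w x j‖ * ‖fderiv ℝ u x h 2‖) := by
        gcongr
        · exact (norm_add_le _ _).trans (by rw [norm_mul, norm_mul])
        · exact (norm_add_le _ _).trans (by rw [norm_mul, norm_mul])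
    _ ≤ (Mu * ‖h‖ * Bw + Bu * (Mw * ‖h‖)) + (Mw * ‖h‖ * Bu + Bw * (Mu * ‖h‖)) := by
        have hh : 0 ≤ ‖h‖ := norm_nonneg h
        have t1 : ‖fderiv ℝ u x h j‖ * ‖w x 2‖ ≤ Mu * ‖h‖ * Bw :=
          mul_le_mul (e1 j) (b2 2) (norm_nonneg _) (by positivity)
        have t2 : ‖u x j‖ * ‖fderiv ℝ w x h 2‖ ≤ Bu * (Mw * ‖h‖) :=
          mul_le_mul (b1 j) (e2 2) (norm_nonneg _) hBu0
        have t3 : ‖fderiv ℝ w x h j‖ * ‖u x 2‖ ≤ Mw * ‖h‖ * Bu :=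
          mul_le_mul (e2 j) (b1 2) (norm_nonneg _) (by positivity)
        have t4 : ‖w x j‖ * ‖fderiv ℝ u x h 2‖ ≤ Bw * (Mu * ‖h‖) :=
          mul_le_mul (b2 j) (e1 2) (norm_nonneg _) hBw0
        linarith
    _ = 2 * (Mu * Bw + Bu * Mw) * ‖h‖ := by ring

/-- **THE WINDOWED TILTING FLUX.**  For bounded `C¹` fields `u, ω` on `ℝ³` with bounded gradients and `div u = div ω = 0`,
every `L > 0`, height `c` and centre `a`: the windowed transport-minus-stretching of the `e₃`-component through the plane
`{x₂ = c}` is integrable and equals the pairing of the horizontal flux `Fⱼ = uⱼω₂ − ωⱼu₂` with the window GRADIENT,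
`∫ [((u·∇)ω)₂ − ((ω·∇)u)₂](y₀,y₁,c) g_{L,a}(y) dy = −∫ F₀ ∂₀g_{L,a} − ∫ F₁ ∂₁g_{L,a}`. -/
theorem integral_convect_sub_stretch_two_mul_gaussWin (hu : ContDiff ℝ 1 u) (hw : ContDiff ℝ 1 w) {Bu Bw Mu Mw : ℝ}
    (hBu : ∀ x, ‖u x‖ ≤ Bu) (hBw : ∀ x, ‖w x‖ ≤ Bw) (hMu : ∀ x, ‖fderiv ℝ u x‖ ≤ Mu)
    (hMw : ∀ x, ‖fderiv ℝ w x‖ ≤ Mw) (hdivu : VectorCalculus.IsDivFree u) (hdivw : VectorCalculus.IsDivFree w)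
    {L : ℝ} (hL : 0 < L) (c : ℝ) (a : EuclideanSpace ℝ (Fin 2)) :
    Integrable (fun y => (convect u w (planePt c y) 2 - convect w u (planePt c y) 2) * gaussWin L a y) ∧
      ∫ y, (convect u w (planePt c y) 2 - convect w u (planePt c y) 2) * gaussWin L a y =
        -(∫ y, (u (planePt c y) 0 * w (planePt c y) 2 - w (planePt c y) 0 * u (planePt c y) 2) *
            fderiv ℝ (gaussWin L a) y (EuclideanSpace.single 0 1)) -
          ∫ y, (u (planePt c y) 1 * w (planePt c y) 2 - w (planePt c y) 1 * u (planePt c y) 2) *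
            fderiv ℝ (gaussWin L a) y (EuclideanSpace.single 1 1) := by
  have hud : Differentiable ℝ u := hu.differentiable one_ne_zero
  have hwd : Differentiable ℝ w := hw.differentiable one_ne_zero
  -- the two horizontal flux components as `C¹` bounded scalars with bounded gradient
  have h0 := integral_fderiv_planePt_mul_gaussWin (contDiff_flux hu hw 0) (norm_flux_le hBu hBw 0)
    (norm_fderiv_flux_le hu hw hBu hBw hMu hMw 0) hL c a 0
  have h1 := integral_fderiv_planePt_mul_gaussWin (contDiff_flux hu hw 1) (norm_flux_le hBu hBw 1)
    (norm_fderiv_flux_le hu hw hBu hBw hMu hMw 1) hL c a 1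
  obtain ⟨I0, -, E0⟩ := h0
  obtain ⟨I1, -, E1⟩ := h1
  -- the pointwise divergence structure on the plane
  have hpt : ∀ y, (convect u w (planePt c y) 2 - convect w u (planePt c y) 2) * gaussWin L a y =
      fderiv ℝ (fun x => u x 0 * w x 2 - w x 0 * u x 2) (planePt c y) (EuclideanSpace.single (Fin.castSucc 0) 1) *
          gaussWin L a y +
        fderiv ℝ (fun x => u x 1 * w x 2 - w x 1 * u x 2) (planePt c y) (EuclideanSpace.single (Fin.castSucc 1) 1) *
          gaussWin L a y := by
    intro y
    rw [convect_sub_stretch_two_eq_divh (hud _) (hwd _) (hdivu _) (hdivw _), add_mul]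
    rfl
  have hfun : (fun y => (convect u w (planePt c y) 2 - convect w u (planePt c y) 2) * gaussWin L a y) =
      fun y => fderiv ℝ (fun x => u x 0 * w x 2 - w x 0 * u x 2) (planePt c y) (EuclideanSpace.single (Fin.castSucc 0) 1) *
          gaussWin L a y +
        fderiv ℝ (fun x => u x 1 * w x 2 - w x 1 * u x 2) (planePt c y) (EuclideanSpace.single (Fin.castSucc 1) 1) *
          gaussWin L a y := funext hpt
  refine ⟨?_, ?_⟩
  · rw [hfun]; exact I0.add I1
  · rw [hfun, integral_add I0 I1, E0, E1]
    ring

/-- **The windowed tilting flux is `O(1/L)`**: under the hypotheses of `integral_convect_sub_stretch_two_mul_gaussWin`,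
`|∫ [((u·∇)ω)₂ − ((ω·∇)u)₂](y₀,y₁,c) g_{L,a}(y) dy| ≤ 8 B_u B_ω / L` (`|Fⱼ| ≤ 2B_uB_ω`, `‖∇g_{L,a}‖_{L¹(ℝ²)} ≤ 2/L`). -/
theorem abs_integral_convect_sub_stretch_two_mul_gaussWin_le (hu : ContDiff ℝ 1 u) (hw : ContDiff ℝ 1 w)
    {Bu Bw Mu Mw : ℝ} (hBu : ∀ x, ‖u x‖ ≤ Bu) (hBw : ∀ x, ‖w x‖ ≤ Bw) (hMu : ∀ x, ‖fderiv ℝ u x‖ ≤ Mu)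
    (hMw : ∀ x, ‖fderiv ℝ w x‖ ≤ Mw) (hdivu : VectorCalculus.IsDivFree u) (hdivw : VectorCalculus.IsDivFree w)
    {L : ℝ} (hL : 0 < L) (c : ℝ) (a : EuclideanSpace ℝ (Fin 2)) :
    |∫ y, (convect u w (planePt c y) 2 - convect w u (planePt c y) 2) * gaussWin L a y| ≤ 8 * Bu * Bw / L := by
  have hBu0 : 0 ≤ Bu := (norm_nonneg _).trans (hBu 0)
  have hBw0 : 0 ≤ Bw := (norm_nonneg _).trans (hBw 0)
  have hF0 : 0 ≤ 2 * Bu * Bw := by positivity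
  have hDg_int := integrable_fderiv_gaussWin hL a
  -- each pairing `∫ Fⱼ ∂ⱼg` is bounded by `2B_uB_w · ‖∇g‖₁ ≤ 2B_uB_w · 2/L`
  have hterm : ∀ j : Fin 2, |∫ y, (u (planePt c y) (Fin.castSucc j) * w (planePt c y) 2 -
      w (planePt c y) (Fin.castSucc j) * u (planePt c y) 2) * fderiv ℝ (gaussWin L a) y (EuclideanSpace.single j 1)| ≤
      2 * Bu * Bw * (2 / L) := by
    intro j
    have h1 : ‖∫ y, (u (planePt c y) (Fin.castSucc j) * w (planePt c y) 2 -
        w (planePt c y) (Fin.castSucc j) * u (planePt c y) 2) * fderiv ℝ (gaussWin L a) y (EuclideanSpace.single j 1)‖ ≤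
        ∫ y, 2 * Bu * Bw * ‖fderiv ℝ (gaussWin L a) y‖ := by
      refine norm_integral_le_of_norm_le (hDg_int.norm.const_mul _) (ae_of_all _ fun y => ?_)
      rw [norm_mul]
      refine mul_le_mul (norm_flux_le hBu hBw _ _) ?_ (norm_nonneg _) hF0
      have h2 := abs_fderiv_gaussWin_apply_le (L := L) a y (EuclideanSpace.single j 1)
      rw [PiLp.norm_single, norm_one, mul_one] at h2
      rwa [Real.norm_eq_abs]
    rw [Real.norm_eq_abs, integral_const_mul] at h1
    exact h1.trans (mul_le_mul_of_nonneg_left (integral_norm_fderiv_gaussWin_le hL a) hF0)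
  rw [(integral_convect_sub_stretch_two_mul_gaussWin hu hw hBu hBw hMu hMw hdivu hdivw hL c a).2]
  have h0 := hterm 0
  have h1 := hterm 1
  simp only [Fin.castSucc_zero, Fin.castSucc_one] at h0 h1
  calc |-(∫ y, (u (planePt c y) 0 * w (planePt c y) 2 - w (planePt c y) 0 * u (planePt c y) 2) *
            fderiv ℝ (gaussWin L a) y (EuclideanSpace.single 0 1)) -
          ∫ y, (u (planePt c y) 1 * w (planePt c y) 2 - w (planePt c y) 1 * u (planePt c y) 2) *
            fderiv ℝ (gaussWin L a) y (EuclideanSpace.single 1 1)|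
      ≤ |∫ y, (u (planePt c y) 0 * w (planePt c y) 2 - w (planePt c y) 0 * u (planePt c y) 2) *
            fderiv ℝ (gaussWin L a) y (EuclideanSpace.single 0 1)| +
          |∫ y, (u (planePt c y) 1 * w (planePt c y) 2 - w (planePt c y) 1 * u (planePt c y) 2) *
            fderiv ℝ (gaussWin L a) y (EuclideanSpace.single 1 1)| := by
        rw [← neg_add', abs_neg]
        exact abs_add_le _ _
    _ ≤ 2 * Bu * Bw * (2 / L) + 2 * Bu * Bw * (2 / L) := add_le_add h0 h1
    _ = 8 * Bu * Bw / L := by ring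

end TiltingFlux

end Summit.NavierStokesRegularity.NavierStokesRegularity.Theorems.HalfSpaceWindowDoorCirculationCarryingRigidityTiltingFlux

end
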